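import Summits.AtomisticToContinuum.BoseEinsteinCondensation.Theorems.BECGroundStateSOSPeriodicIRBoundFsumDefs
import Summits.AtomisticToContinuum.BoseEinsteinCondensation.Theorems.BECGroundStateSOSPeriodicIRBoundFsumConeCS
import Summits.AtomisticToContinuum.BoseEinsteinCondensation.Theorems.BECGroundStateSOSPeriodicIRBoundWFHeartKin2
import Literature.MathematicalPhysics.QuantumManyBody.PeriodicFormCauchySchwarz
import HarnessLib

/-!
# Crux `PeriodicIRBound` (stmt-AtomisticToContinuum-3972), line `fsum-phase-pencil`, stub S3
# `stub_phaseDoubleCommutator` — part 1: adjointness and commutator algebra of the one-body lift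

The one-body lift `transfer L a b = a†(φ_a) a(φ_b)` (`T_{ab}`) on `(n+2)`-body core functions:

* linear-algebra bookkeeping of the real pairing `Re⟨f, g⟩` (`innerRe`): additivity, homogeneity,
  `Re⟨f, f⟩ = ‖f‖²`, `2|Re⟨f, g⟩| ≤ ‖f‖² + ‖g‖²`;
* the commutator with an annihilator, `a_q T_{ab} = T_{ab} a_q + [q = a] a_b` (CCR on plane-wave modes
  `WF.modeAn_modeCr_planeWaveMode` and `[a_q, a_b] = 0`, `WF.modeAn_modeAn_planeWaveMode_comm`);
* adjointness `⟨T_{ab} g, Ψ⟩ = ⟨g, T_{ba} Ψ⟩` and `Re⟨a_a g, a_b Ψ⟩ = Re⟨g, T_{ab} Ψ⟩`;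
* summability of the polarised kinetic Parseval series `∑_q ε_q Re⟨a_q f, a_q g⟩`;
* the **twisted kinetic adjointness** `Re B_0(T_{ba} g, Ψ) = Re B_0(g, T_{ab} Ψ) + (ε_b − ε_a) Re⟨a_a g, a_b Ψ⟩`
  (`[T, a_a† a_b] = (ε_a − ε_b) a_a† a_b` in the form sense; polarised Parseval `WF.formRe_zero_eq_tsum`),
  registered by-product sub-goal `stub_fsumDCAdjoint`.
-/

noncomputable section

open MeasureTheory Filter
open scoped ENNReal NNReal ComplexConjugate BigOperators

namespace Summit.AtomisticToContinuum.BoseEinsteinCondensation.Cruxes.PeriodicIRBound.FsumPhasePencil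

open Literature.MathematicalPhysics.QuantumManyBody.BoseGas
open Summit.AtomisticToContinuum.BoseEinsteinCondensation.Cruxes.PeriodicIRBound.LinearPhFloorWagner.WF

variable {M n : ℕ} {L : ℝ}

/-! ## The real pairing `Re⟨f, g⟩` -/

section InnerRe

variable {f g h : Config M → ℂ}

/-- `Re⟨f + g, h⟩ = Re⟨f, h⟩ + Re⟨g, h⟩` (continuous functions on the cell). [folklore] -/
theorem innerRe_add_left (hf : Continuous f) (hg : Continuous g) (hh : Continuous h) :
    innerRe L (fun X => f X + g X) h = innerRe L f h + innerRe L g h := by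
  unfold innerRe
  have h1 : Integrable (fun X => conj (f X) * h X) (volume.restrict (cellN M L)) :=
    integrableOn_cellN ((Complex.continuous_conj.comp hf).mul hh) L
  have h2 : Integrable (fun X => conj (g X) * h X) (volume.restrict (cellN M L)) :=
    integrableOn_cellN ((Complex.continuous_conj.comp hg).mul hh) L
  simp only [map_add, add_mul]
  rw [integral_add h1 h2, Complex.add_re]

/-- `Re⟨f, g + h⟩ = Re⟨f, g⟩ + Re⟨f, h⟩`. [folklore] -/
theorem innerRe_add_right (hf : Continuous f) (hg : Continuous g) (hh : Continuous h) :
    innerRe L f (fun X => g X + h X) = innerRe L f g + innerRe L f h := by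
  rw [innerRe_comm, innerRe_add_left hg hh hf, innerRe_comm L g f, innerRe_comm L h f]

/-- `Re⟨−f, g⟩ = −Re⟨f, g⟩`. [folklore] -/
theorem innerRe_neg_left (f g : Config M → ℂ) : innerRe L (fun X => -f X) g = -innerRe L f g := by
  unfold innerRe
  simp only [map_neg, neg_mul]
  rw [integral_neg, Complex.neg_re]

/-- `Re⟨f, −g⟩ = −Re⟨f, g⟩`. [folklore] -/
theorem innerRe_neg_right (f g : Config M → ℂ) : innerRe L f (fun X => -g X) = -innerRe L f g := by
  rw [innerRe_comm, innerRe_neg_left, innerRe_comm]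

/-- `Re⟨f − g, h⟩ = Re⟨f, h⟩ − Re⟨g, h⟩`. [folklore] -/
theorem innerRe_sub_left (hf : Continuous f) (hg : Continuous g) (hh : Continuous h) :
    innerRe L (fun X => f X - g X) h = innerRe L f h - innerRe L g h := by
  simp only [sub_eq_add_neg]
  rw [innerRe_add_left (g := fun X => -g X) hf hg.neg hh, innerRe_neg_left]

/-- `Re⟨f, g − h⟩ = Re⟨f, g⟩ − Re⟨f, h⟩`. [folklore] -/
theorem innerRe_sub_right (hf : Continuous f) (hg : Continuous g) (hh : Continuous h) :
    innerRe L f (fun X => g X - h X) = innerRe L f g - innerRe L f h := by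
  rw [innerRe_comm, innerRe_sub_left hg hh hf, innerRe_comm L g f, innerRe_comm L h f]

/-- `Re⟨c f, g⟩ = c Re⟨f, g⟩` for real `c`. [folklore] -/
theorem innerRe_smul_left (c : ℝ) (f g : Config M → ℂ) :
    innerRe L (fun X => (c : ℂ) * f X) g = c * innerRe L f g := by
  unfold innerRe
  simp only [map_mul, Complex.conj_ofReal, mul_assoc]
  rw [integral_const_mul, Complex.re_ofReal_mul]

/-- `Re⟨f, c g⟩ = c Re⟨f, g⟩` for real `c`. [folklore] -/
theorem innerRe_smul_right (c : ℝ) (f g : Config M → ℂ) :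
    innerRe L f (fun X => (c : ℂ) * g X) = c * innerRe L f g := by
  rw [innerRe_comm, innerRe_smul_left, innerRe_comm]

/-- `Re⟨f, f⟩ = ‖f‖²`. [folklore] -/
theorem innerRe_self (hf : Continuous f) : innerRe L f f = (normSq L f).toReal := by
  unfold innerRe
  rw [integral_conj_mul_self_eq L hf, Complex.ofReal_re]

/-- Cauchy–Schwarz `Re⟨f, g⟩² ≤ ‖f‖² ‖g‖²`. [folklore] -/
theorem innerRe_sq_le (hf : Continuous f) (hg : Continuous g) :
    innerRe L f g ^ 2 ≤ (normSq L f).toReal * (normSq L g).toReal := by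
  rw [← integral_re_conj_mul hf hg, toReal_normSq hf, toReal_normSq hg, mul_comm]
  exact sq_integral_re_conj_mul_le hg hf L

/-- `2|Re⟨f, g⟩| ≤ ‖f‖² + ‖g‖²`. [folklore] -/
theorem two_mul_abs_innerRe_le (hf : Continuous f) (hg : Continuous g) :
    2 * |innerRe L f g| ≤ (normSq L f).toReal + (normSq L g).toReal := by
  have h := innerRe_sq_le (L := L) hf hg
  have ha : 0 ≤ (normSq L f).toReal := ENNReal.toReal_nonneg
  have hb : 0 ≤ (normSq L g).toReal := ENNReal.toReal_nonneg
  nlinarith [sq_nonneg ((normSq L f).toReal - (normSq L g).toReal), sq_abs (innerRe L f g),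
    abs_nonneg (innerRe L f g), sq_nonneg (2 * |innerRe L f g| - (normSq L f).toReal - (normSq L g).toReal)]

end InnerRe

/-! ## The one-body lift on `(n+1)`- and `(n+2)`-body functions -/

section Transfer

/-- Unfolding `transfer` on a positive sector. [folklore] -/
theorem transfer_succ (L : ℝ) (a b : Fin 3 → ℤ) (Ψ : Config (n + 1) → ℂ) :
    transfer L a b Ψ = modeCr (planeWaveMode L a) (modeAn L (planeWaveMode L b) Ψ) := rfl

/-- `transfer L a b Ψ` is continuous for continuous `Ψ`. [folklore] -/
theorem continuous_transfer (L : ℝ) (a b : Fin 3 → ℤ) {Ψ : Config (n + 1) → ℂ} (hΨ : Continuous Ψ) :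
    Continuous (transfer L a b Ψ) :=
  continuous_modeCr (continuous_planeWaveMode L a) (continuous_modeAn L (continuous_planeWaveMode L b) hΨ)

/-- `transfer L a b Ψ` is Bose-symmetric for symmetric `Ψ`. [folklore] -/
theorem isSymm_transfer (L : ℝ) (a b : Fin 3 → ℤ) {Ψ : Config (n + 1) → ℂ} (hΨ : IsSymm Ψ) :
    IsSymm (transfer L a b Ψ) :=
  isSymm_modeCr (isSymm_modeAn hΨ)

/-- **The commutator with an annihilator**: `a_q (T_{ab} Ψ) = T_{ab} (a_q Ψ) + [q = a] a_b Ψ` for a continuous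
Bose-symmetric `(n+2)`-body `Ψ` (CCR `a_q a_a† = [q = a] + a_a† a_q` on the continuous `a_b Ψ`, then
`a_q a_b = a_b a_q`). [folklore] -/
theorem modeAn_transfer (hL : 0 < L) (q a b : Fin 3 → ℤ) {Ψ : Config (n + 2) → ℂ} (hΨ : Continuous Ψ)
    (hsymm : IsSymm Ψ) :
    modeAn L (planeWaveMode L q) (transfer L a b Ψ) = fun Y =>
      transfer L a b (modeAn L (planeWaveMode L q) Ψ) Y +
        (if q = a then modeAn L (planeWaveMode L b) Ψ Y else 0) := by
  have hb : Continuous (modeAn L (planeWaveMode L b) Ψ) := continuous_modeAn L (continuous_planeWaveMode L b) hΨ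
  rw [transfer_succ, modeAn_modeCr_planeWaveMode hL q a hb, modeAn_modeAn_planeWaveMode_comm q b hΨ hsymm]
  funext Y
  rw [add_comm]
  rfl

/-- **Adjointness of the lift**: `⟨T_{ab} g, Ψ⟩ = ⟨g, T_{ba} Ψ⟩` (complex pairings on the cell) for continuous
Bose-symmetric `(n+1)`-body `g, Ψ`. [folklore] -/
theorem integral_conj_transfer_mul (a b : Fin 3 → ℤ) {g Ψ : Config (n + 1) → ℂ} (hg : Continuous g)
    (hgs : IsSymm g) (hΨ : Continuous Ψ) (hΨs : IsSymm Ψ) :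
    ∫ X in cellN (n + 1) L, conj (transfer L a b g X) * Ψ X =
      ∫ X in cellN (n + 1) L, conj (g X) * transfer L b a Ψ X := by
  rw [transfer_succ, transfer_succ,
    integral_conj_modeCr_mul (continuous_planeWaveMode L a).measurable (norm_planeWaveMode_le L a)
      (continuous_modeAn L (continuous_planeWaveMode L b) hg) hΨ hΨs]
  exact integral_conj_modeAn_planeWaveMode_mul b (continuous_modeAn L (continuous_planeWaveMode L a) hΨ) hg hgs

/-- `Re⟨T_{ab} g, Ψ⟩ = Re⟨g, T_{ba} Ψ⟩`. [folklore] -/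
theorem innerRe_transfer_left (a b : Fin 3 → ℤ) {g Ψ : Config (n + 1) → ℂ} (hg : Continuous g)
    (hgs : IsSymm g) (hΨ : Continuous Ψ) (hΨs : IsSymm Ψ) :
    innerRe L (transfer L a b g) Ψ = innerRe L g (transfer L b a Ψ) := by
  unfold innerRe
  rw [integral_conj_transfer_mul a b hg hgs hΨ hΨs]

/-- `Re⟨a_a g, a_b Ψ⟩ = Re⟨g, T_{ab} Ψ⟩` for continuous `(n+1)`-body `g, Ψ` with `g` Bose-symmetric. [folklore] -/
theorem innerRe_modeAn_modeAn (a b : Fin 3 → ℤ) {g Ψ : Config (n + 1) → ℂ} (hg : Continuous g)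
    (hgs : IsSymm g) (hΨ : Continuous Ψ) :
    innerRe L (modeAn L (planeWaveMode L a) g) (modeAn L (planeWaveMode L b) Ψ) = innerRe L g (transfer L a b Ψ) := by
  unfold innerRe
  rw [integral_conj_modeAn_planeWaveMode_mul a (continuous_modeAn L (continuous_planeWaveMode L b) hΨ) hg hgs]
  rfl

end Transfer

/-! ## Summability of the polarised kinetic Parseval series -/

section Parseval

/-- The occupation series `∑_q ε_q ‖a_q f‖²` of a core function is finite (it is `T[f]`). [folklore] -/
theorem tsum_eps_mul_occ_ne_top (hL : 0 < L) {f : Config (n + 1) → ℂ} (hf : IsCore L f) :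
    (∑' q : Fin 3 → ℤ, eps L q * normSq L (modeAn L (planeWaveMode L q) f)) ≠ ⊤ := by
  have h := lintegral_kineticDensity_eq_tsum_normSq_modeAn hL hf
  rw [← qform_zero_eq] at h
  rw [show (fun q : Fin 3 → ℤ => eps L q * normSq L (modeAn L (planeWaveMode L q) f)) =
      fun q => ENNReal.ofReal (‖waveVector L q‖ ^ 2) * normSq L (modeAn L (planeWaveMode L q) f) from rfl, ← h]
  exact qform_zero_ne_top L hf.contDiff

/-- The real occupation series `q ↦ ε_q ‖a_q f‖²` of a core function is summable. [folklore] -/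
theorem summable_eps_mul_normSq_modeAn (hL : 0 < L) {f : Config (n + 1) → ℂ} (hf : IsCore L f) :
    Summable fun q : Fin 3 → ℤ => (eps L q).toReal * (normSq L (modeAn L (planeWaveMode L q) f)).toReal := by
  have := ENNReal.summable_toReal (tsum_eps_mul_occ_ne_top hL hf)
  refine this.congr fun q => ?_
  rw [ENNReal.toReal_mul]

/-- **Summability of the polarised Parseval series** `q ↦ ε_q Re⟨a_q f, a_q g⟩` for core `f, g`
(`2|Re⟨u, v⟩| ≤ ‖u‖² + ‖v‖²` and the kinetic Parseval). [folklore] -/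
theorem summable_eps_mul_innerRe (hL : 0 < L) {f g : Config (n + 1) → ℂ} (hf : IsCore L f) (hg : IsCore L g) :
    Summable fun q : Fin 3 → ℤ => (eps L q).toReal *
      innerRe L (modeAn L (planeWaveMode L q) f) (modeAn L (planeWaveMode L q) g) := by
  have hs := (summable_eps_mul_normSq_modeAn hL hf).add (summable_eps_mul_normSq_modeAn hL hg)
  refine Summable.of_norm_bounded hs fun q => ?_
  have hu : Continuous (modeAn L (planeWaveMode L q) f) := (isCore_modeAn hL q hf).contDiff.continuous
  have hv : Continuous (modeAn L (planeWaveMode L q) g) := (isCore_modeAn hL q hg).contDiff.continuous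
  have h2 := two_mul_abs_innerRe_le (L := L) hu hv
  have hε : 0 ≤ (eps L q).toReal := ENNReal.toReal_nonneg
  rw [Real.norm_eq_abs, abs_mul, abs_of_nonneg hε, ← mul_add]
  refine mul_le_mul_of_nonneg_left ?_ hε
  linarith [abs_nonneg (innerRe L (modeAn L (planeWaveMode L q) f) (modeAn L (planeWaveMode L q) g))]

/-- `ε_0 = 0`. [folklore] -/
theorem eps_zero (L : ℝ) : eps L 0 = 0 := by
  rw [eps, waveVector_zero, norm_zero, zero_pow two_ne_zero, ENNReal.ofReal_zero]

/-- `ε_{−k} = ε_k`. [folklore] -/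
theorem eps_neg (L : ℝ) (k : Fin 3 → ℤ) : eps L (-k) = eps L k := by
  rw [eps, eps, waveVector_neg, norm_neg]

/-- `ε_k.toReal = ‖k̃‖²`. [folklore] -/
theorem toReal_eps_eq (L : ℝ) (k : Fin 3 → ℤ) : (eps L k).toReal = ‖waveVector L k‖ ^ 2 := by
  rw [eps, ENNReal.toReal_ofReal (sq_nonneg _)]

end Parseval

/-! ## The twisted kinetic adjointness of the lift -/

section Twisted

/-- **Twisted kinetic adjointness of the one-body lift** (the form version of
`[T, a_a† a_b] = (ε_a − ε_b) a_a† a_b`): for core `(n+2)`-body `g, Ψ`,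
`Re B_0(T_{ba} g, Ψ) = Re B_0(g, T_{ab} Ψ) + (ε_b − ε_a) · Re⟨a_a g, a_b Ψ⟩`
(polarised kinetic Parseval, the commutator `a_q T_{ab} = T_{ab} a_q + [q = a] a_b`, adjointness of `T` one
particle down). [folklore] -/
theorem formRe_zero_transfer_left (hL : 0 < L) (a b : Fin 3 → ℤ) {g Ψ : Config (n + 2) → ℂ} (hg : IsCore L g)
    (hΨ : IsCore L Ψ) :
    formRe 0 L (transfer L b a g) Ψ = formRe 0 L g (transfer L a b Ψ) +
      ((eps L b).toReal - (eps L a).toReal) *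
        innerRe L (modeAn L (planeWaveMode L a) g) (modeAn L (planeWaveMode L b) Ψ) := by
  -- notation
  set X : ℝ := innerRe L (modeAn L (planeWaveMode L a) g) (modeAn L (planeWaveMode L b) Ψ) with hX
  have hgc := hg.contDiff.continuous
  have hΨc := hΨ.contDiff.continuous
  have hTg : IsCore L (transfer L b a g) := isCore_modeCr hL b (isCore_modeAn hL a hg)
  have hTΨ : IsCore L (transfer L a b Ψ) := isCore_modeCr hL a (isCore_modeAn hL b hΨ)
  have hqg : ∀ q, IsCore L (modeAn L (planeWaveMode L q) g) := fun q => isCore_modeAn hL q hg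
  have hqΨ : ∀ q, IsCore L (modeAn L (planeWaveMode L q) Ψ) := fun q => isCore_modeAn hL q hΨ
  -- the two Parseval series
  rw [formRe_zero_eq_tsum hL hTg hΨ, formRe_zero_eq_tsum hL hg hTΨ]
  set R : (Fin 3 → ℤ) → ℝ := fun q => (eps L q).toReal *
    innerRe L (modeAn L (planeWaveMode L q) g) (modeAn L (planeWaveMode L q) (transfer L a b Ψ)) with hR
  have hRs : Summable R := summable_eps_mul_innerRe hL hg hTΨ
  -- termwise identity
  have hterm : ∀ q, (eps L q).toReal *
      innerRe L (modeAn L (planeWaveMode L q) (transfer L b a g)) (modeAn L (planeWaveMode L q) Ψ) =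
      R q + ((if q = b then (eps L b).toReal * X else 0) - (if q = a then (eps L a).toReal * X else 0)) := by
    intro q
    have hcomm_g := modeAn_transfer hL q b a hgc hg.symm
    have hcomm_Ψ := modeAn_transfer hL q a b hΨc hΨ.symm
    have hqgc := (hqg q).contDiff.continuous
    have hqΨc := (hqΨ q).contDiff.continuous
    have hag : Continuous (modeAn L (planeWaveMode L a) g) := (hqg a).contDiff.continuous
    have hbΨ : Continuous (modeAn L (planeWaveMode L b) Ψ) := (hqΨ b).contDiff.continuous
    -- left series term
    have h1 : innerRe L (modeAn L (planeWaveMode L q) (transfer L b a g)) (modeAn L (planeWaveMode L q) Ψ) =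
        innerRe L (transfer L b a (modeAn L (planeWaveMode L q) g)) (modeAn L (planeWaveMode L q) Ψ) +
          (if q = b then innerRe L (modeAn L (planeWaveMode L a) g) (modeAn L (planeWaveMode L q) Ψ) else 0) := by
      rw [hcomm_g]
      by_cases hqb : q = b
      · simp only [hqb, ↓reduceIte]
        exact innerRe_add_left (continuous_transfer L b a ((hqg b).contDiff.continuous)) hag
          ((hqΨ b).contDiff.continuous)
      · simp only [hqb, ↓reduceIte, add_zero]
    -- adjointness one particle down, then the commutator on `Ψ`
    have h2 : innerRe L (transfer L b a (modeAn L (planeWaveMode L q) g)) (modeAn L (planeWaveMode L q) Ψ) =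
        innerRe L (modeAn L (planeWaveMode L q) g) (modeAn L (planeWaveMode L q) (transfer L a b Ψ)) -
          (if q = a then innerRe L (modeAn L (planeWaveMode L q) g) (modeAn L (planeWaveMode L b) Ψ) else 0) := by
      rw [innerRe_transfer_left b a hqgc (hqg q).symm hqΨc (hqΨ q).symm, hcomm_Ψ]
      by_cases hqa : q = a
      · simp only [hqa, ↓reduceIte]
        rw [innerRe_add_right ((hqg a).contDiff.continuous)
          (continuous_transfer L a b ((hqΨ a).contDiff.continuous)) hbΨ]
        ring
      · simp only [hqa, ↓reduceIte, add_zero, sub_zero]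
    rw [h1, h2, hR]
    by_cases hqb : q = b
    · subst hqb
      by_cases hqa : q = a
      · subst hqa
        simp only [↓reduceIte, hX]
        ring
      · simp only [↓reduceIte, hqa, hX]
        ring
    · by_cases hqa : q = a
      · subst hqa
        simp only [↓reduceIte, hqb, hX]
        ring
      · simp only [hqb, hqa, ↓reduceIte]
        ring
  -- sum the termwise identity
  have hfb : Summable fun q : Fin 3 → ℤ => (if q = b then (eps L b).toReal * X else 0) :=
    summable_of_ne_finset_zero (s := {b}) fun q hq => by
      rw [Finset.mem_singleton] at hq; simp [hq]
  have hfa : Summable fun q : Fin 3 → ℤ => (if q = a then (eps L a).toReal * X else 0) :=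
    summable_of_ne_finset_zero (s := {a}) fun q hq => by
      rw [Finset.mem_singleton] at hq; simp [hq]
  rw [tsum_congr hterm, hRs.tsum_add (hfb.sub hfa), hfb.tsum_sub hfa, tsum_ite_eq b, tsum_ite_eq a]
  ring

/-- **Registered by-product sub-goal `stub_fsumDCAdjoint`** (line `fsum-phase-pencil`, helper of S3
`stub_phaseDoubleCommutator`): the twisted kinetic adjointness `formRe_zero_transfer_left`. [folklore] -/
theorem stub_fsumDCAdjoint : ∀ {n : ℕ} {L : ℝ}, 0 < L → ∀ (a b : Fin 3 → ℤ) {g Ψ : Config (n + 2) → ℂ}, IsCore L g → IsCore L Ψ → formRe 0 L (transfer L b a g) Ψ = formRe 0 L g (transfer L a b Ψ) + ((eps L b).toReal - (eps L a).toReal) * innerRe L (modeAn L (planeWaveMode L a) g) (modeAn L (planeWaveMode L b) Ψ) :=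
  fun hL a b _ _ hg hΨ => formRe_zero_transfer_left hL a b hg hΨ

end Twisted

end Summit.AtomisticToContinuum.BoseEinsteinCondensation.Cruxes.PeriodicIRBound.FsumPhasePencil

end
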